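import Literature.NumberTheory.Automorphic.ShimuraCurveRibetTakahashiBrandtDictionaryProofs
import Literature.NumberTheory.EllipticCurves.KatzPrimePowerEisensteinTorsionProofs
import HarnessLib

/-!
# Pasten's Thm. 6.1 (b) from the character-group dictionaries and Mazur's TORSION theorem:
# Lemma 6.7 at every prime is Katz 1981 + Mazur 1977

Topic `NumberTheory/Automorphic`; a proofs-only companion (theorems only: no definition, no named
fact, nothing restated; D-0026) of `ShimuraCurveRibetTakahashi.lean`, written by the seat of its
named fact `Literature.NumberTheory.Automorphic.PastenShimura2024_thm_6_1_b` (H. Pasten, *Shimura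
curves and the abc conjecture*, J. Number Theory 254 (2024) 214–335 = arXiv:1705.09251, Thm. 6.1 (b)
p. 20), continuing `ShimuraCurveRibetTakahashiBrandtDictionaryProofs.lean`.

**The point.** That file proved `PastenShimura2024_thm_6_1_b` from seven named facts, the two
character-group dictionaries `hDict`/`hDictDisc` (or `hDict` and Takahashi's `hT2`), and ONE more
printed input taken as a hypothesis: (`h67small`) Pasten's Lemma 6.7 (p. 22) for the primes
`ℓ ≤ 163` — "for every prime `ℓ` an integer `β_S(ℓ)` such that every `A/ℚ` semi-stable away from
`S` has infinitely many primes `r` with `a_r(A) ≢ r + 1 mod ℓ^{β_S(ℓ)}`", printed proof from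
FALTINGS' theorem on the modular curves `Y_H` (Lemmas 6.4–6.6, `β` non-effective) — while the primes
`ℓ > 163` (Lemma 6.3) came from Mazur's ISOGENY theorem (`mazur_isogeny_irreducible`).

Both are now theorems of the tree over Mazur's TORSION theorem alone (named fact
`Literature.NumberTheory.EllipticCurves.mazur_torsion`, Mazur 1977 Thm. (8), the object of the
tree's `MazurTorsion*` programme): the sibling seat's
`Literature.NumberTheory.EllipticCurves.exists_prime_not_pow_dvd_lFunction_sub_of_mazur_torsion`
(file `EllipticCurves/KatzPrimePowerEisensteinTorsionProofs.lean`) — KATZ 1981, Thm. 2 at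
prime-power level (the lattice theorem, Thm. 1, proved in
`GaloisRepresentations/KatzDetCongruenceLattice.lean`): if `ℓⁿ ∣ a_r(E) − r − 1` for all good
`r ∉ S'` then some curve `ℚ`-isogenous to `E` has rational points of orders `ℓᵃ`, `ℓᵇ`, `a + b = n`,
so that Mazur's bound `12` on rational torsion orders forces `ℓⁿ ≤ 144`. Hence (§I)
**Pasten's Lemma 6.7 VERBATIM — for every finite `S`, every prime `ℓ`, with the EXPLICIT exponent
`β(ℓ) = 1` for `ℓ > 144` and `β(ℓ) = 8` otherwise, for every `E/ℚ` (the semi-stability hypothesis is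
not used)** — `PastenShimura2024_lemma_6_7_of_mazur_torsion`, in exactly the shape of the hypothesis
`h67` of `…CokernelProofs`, `…FreyDiophantineProofs`, `…FreyCubicProofs`, `…BrandtCoordinatesProofs`,
`…LevelOneAssemblyProofs`, `…PairwiseTakahashiProofs`, `…PairwiseDenominatorProofs` (so each of those
reductions now runs with `h67 := PastenShimura2024_lemma_6_7_of_mazur_torsion hMT S`); (§II) Lemma
6.14 with the factor `12` over it (`exists_dvd_of_eisenstein12_of_lemma_6_7`, the small-prime branch
of the parallel seat's `exists_dvd_of_eisenstein12_of_mazur` run at EVERY prime: for `ℓ > 163`,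
`β = 1` and `v_ℓ(12) = 0` give `v_ℓ(i) = 0` with no appeal to Mazur's isogeny theorem); (§III) the
"`i_p ∣ κ_S`" package and Thm. 6.1 (b) in coordinates; (§IV) the assembled statements.

**Trust base after this file** (`PastenShimura2024_thm_6_1_b_of_brandtDictionaries_of_mazur_torsion`):
the named facts `mazurKenku_exists_cyclic_isogeny` (Lemma 6.8), `mestreOesterle1989_thm_1` (Lemma
6.11), `nonempty_shimuraParametrizationData` (Jacquet–Langlands), `ribet1997_twoPowerFermat`,
`darmonMerel1997_denesEquation`, Mathlib's statement `FermatLastTheorem` (Lemma 6.12, `ℓ ≥ 5`),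
`mazur_torsion` (Lemmas 6.3 and 6.7, all primes); and the TWO character-group dictionaries `hDict`
(level side, `p ∥ M`, Brandt type `(M/p, Dp)`) and `hDictDisc` (discriminant side, `p ∣ D`, type
`(pM, D/p)`) — Néron-model statements (Deligne–Rapoport/Buzzard, Čerednik–Drinfeld, Raynaud, SGA 7 IX,
multiplicity one) for which the tree has the `D = 1` named facts
`takahashi2001_characterGroupDictionary`, `takahashi2001_brandtEigenLattice_rank_one` only.
`mazur_isogeny_irreducible` and `h67small` are gone; every line of Pasten §6 (Lemmas 6.3, 6.7, 6.8's
use, 6.10, 6.12 at `ℓ = 2, 3`, 6.13–6.17, §6.9) and of Takahashi §2 is a theorem.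

## Contents (sorry-free)

* §I `PastenShimura2024_lemma_6_7_of_mazur_torsion` — Lemma 6.7 verbatim (`h67` shape), and
  `small_lemma_6_7_of_mazur_torsion` (`h67small` shape).
* §II `exists_dvd_of_eisenstein12_of_lemma_6_7`, `exists_dvd_of_eisenstein12_of_mazur_torsion` —
  Lemma 6.14, pointwise, factor `12`.
* §III (section `Dictionary`, hypotheses `hDict`, `cI`, `cJ`, verbatim those of
  `…BrandtDictionaryProofs`): `image_dvd_of_brandtDictionary_of_mazur_torsion`,
  `PastenShimura2024_thm_6_1_b_of_brandtDictionary_coordinates_of_mazur_torsion` (`S = {2}`).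
* §IV `PastenShimura2024_thm_6_1_b_of_brandtDictionary_of_mazur_torsion` (inputs `hDict`, `hT2`),
  `PastenShimura2024_thm_6_1_b_of_brandtDictionaries_of_mazur_torsion` (inputs `hDict`, `hDictDisc`).

## References

* H. Pasten, J. Number Theory 254 (2024) = arXiv:1705.09251: Lemma 6.3 p. 21, Lemmas 6.4–6.7 p. 22,
  Lemma 6.14 (with proof) p. 23, Thm. 6.17 p. 24, §6.9 p. 25 (held text, read). [PastenShimura2024]
* N. M. Katz, *Galois properties of torsion points on abelian varieties*, Invent. Math. 62 (1981)
  481–502, Thms. 1–2 (through the tree's proofs; statement also in Cullinan–Kenney–Voight, J. Théor.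
  Nombres Bordeaux 34 (2022), Thm. 2.3.1, read). [Katz1980] [CullinanKenneyVoight2022]
* B. Mazur, *Modular curves and the Eisenstein ideal*, Publ. Math. IHÉS 47 (1977), Thm. (8).
  [Mazur1977]
* S. Takahashi, J. Number Theory 90 (2001) 74–88: §2 pp. 77–80, Prop. 3.1, Thm. 3.2 (a) p. 82, p. 84.
  [Takahashi2001]

## Mathlib / tree search

Reused (tree): `exists_prime_not_pow_dvd_lFunction_sub_of_mazur_torsion` (Katz + Mazur),
`small_lemma_6_7_of_lemma_6_7`, `dvd_prod_pow_of_factorization_le`,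
`one_le_prod_pow_and_primeFactors_lt`, `levelPackage_of_brandtDictionary`,
`eisenstein12_of_brandtDictionary`, `thm_2_3_level_of_brandtDictionary`,
`thm_2_3_disc_of_brandtDictionary`, `prop_6_13_of_takahashi`, `coker_dvd_of_takahashi`,
`IsAdmissibleFactorization.nonempty_xiSetup_level`, `choice_spec_of_exists`, `choice_pos`,
`PastenShimura2024_thm_6_1_b_of_ribetTakahashi_mestreOesterle_fermatQuartic`,
`ShimuraParametrizationData.IsMinimalFor.deg_dvd_modularDegree`, `lemma_6_8_factorization_form`,
`IsFreyHellegouarch.ordCompl_two_minimalDiscriminantNorm_ne_pow_of_three_le`,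
`LFunction_eq_of_isIsogenous_holds`. Mathlib: `Set.finite_Iic`, `Nat.factorization_mul`,
`Nat.ordProj_dvd`, `Nat.factorization_le_iff_dvd`.
-/

noncomputable section

open scoped MatrixGroups ModularForm BigOperators

namespace Literature.NumberTheory.Automorphic

open Literature.NumberTheory.EllipticCurves (mazurKenku_exists_cyclic_isogeny
  mestreOesterle1989_thm_1 mazur_torsion LFunction_eq_of_isIsogenous_holds
  exists_prime_not_pow_dvd_lFunction_sub_of_mazur_torsion)
open Literature.NumberTheory.EllipticCurves.ModularForms (ModularParametrizationData IsNewformOf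
  PastenShimura2024_lemma_6_8_of_mazurKenku')
open Literature.NumberTheory.DiophantineGeometry (ribet1997_twoPowerFermat
  darmonMerel1997_denesEquation)

/-! ## I. Lemma 6.7 at every prime from Mazur's torsion theorem and Katz's theorem -/

/-- **Pasten 2024, Lemma 6.7, verbatim, with an explicit exponent, from Mazur's TORSION theorem.**
Printed (p. 22): "Let `S` be a finite set of primes. For every prime `ℓ` there is an integer
`β_S(ℓ) ≥ 1`, with `β_S(ℓ) = 1` for `ℓ > 163`, such that for every elliptic curve `A/ℚ` semi-stable
away from `S` there are infinitely many primes `r` with `a_r(A) ≢ r + 1 mod ℓ^{β_S(ℓ)}`" (from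
Faltings' theorem, Lemmas 6.4–6.6, and Mazur's isogeny theorem, Lemma 6.3). Here, granted
`mazur_torsion` for every elliptic curve over `ℚ` (Mazur 1977, Thm. (8)): `β(ℓ) = 1` for `ℓ > 144`
and `β(ℓ) = 8` otherwise, for EVERY `A/ℚ` (the semi-stability hypothesis is not used) — Katz 1981,
Thm. 2 at the prime power `ℓ^β > 144 = 12²` (tree theorem
`exists_prime_not_pow_dvd_lFunction_sub_of_mazur_torsion`, avoiding the finite set of primes `≤ r₀`).
This is exactly the hypothesis `h67` of `PastenShimura2024_thm_6_1_b_of_ribetTakahashi_treeFacts`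
and its siblings. [cite: PastenShimura2024, Lemma 6.7 p. 22 and Lemma 6.3 p. 21] [cite: Katz1980, Thm. 2] [cite: Mazur1977, Thm. (8)] -/
theorem PastenShimura2024_lemma_6_7_of_mazur_torsion
    (hMT : ∀ V : WeierstrassCurve ℚ, mazur_torsion V) (S : Finset ℕ) (ℓ : ℕ) (hℓ : ℓ.Prime) :
    ∃ β : ℕ, (163 < ℓ → β = 1) ∧
      ∀ (A : WeierstrassCurve ℚ) [A.IsElliptic],
        (∀ q : ℕ, q.Prime → q ∉ S → ¬ q ^ 2 ∣ A.conductorNorm ℤ) →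
        ∀ r₀ : ℕ, ∃ r : ℕ, r₀ < r ∧ r.Prime ∧
          ¬ ((ℓ ^ β : ℕ) : ℤ) ∣ (r + 1 : ℤ) - A.LFunction r := by
  haveI : Fact ℓ.Prime := ⟨hℓ⟩
  -- Katz + Mazur at level `ℓ ^ n > 144`, outside the primes `≤ r₀`
  have key : ∀ {n : ℕ}, 144 < ℓ ^ n → ∀ (A : WeierstrassCurve ℚ) [A.IsElliptic] (r₀ : ℕ),
      ∃ r : ℕ, r₀ < r ∧ r.Prime ∧ ¬ ((ℓ ^ n : ℕ) : ℤ) ∣ (r + 1 : ℤ) - A.LFunction r := by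
    intro n hn A _ r₀
    obtain ⟨r, hr, -, hrS, -, hndvd⟩ :=
      exists_prime_not_pow_dvd_lFunction_sub_of_mazur_torsion hMT A ℓ hn (Set.Iic r₀)
        (Set.finite_Iic r₀)
    refine ⟨r, lt_of_not_ge fun h => hrS (Set.mem_Iic.mpr h), hr, fun h => hndvd ?_⟩
    have e : A.LFunction r - (r + 1 : ℤ) = -((r + 1 : ℤ) - A.LFunction r) := by ring
    rw [e]
    exact dvd_neg.mpr h
  by_cases h144 : 144 < ℓ
  · exact ⟨1, fun _ => rfl, fun A _ _ r₀ => key (by rwa [pow_one]) A r₀⟩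
  · refine ⟨8, fun h163 => absurd (lt_trans (by norm_num) h163) h144, fun A _ _ r₀ => key ?_ A r₀⟩
    calc 144 < 2 ^ 8 := by norm_num
      _ ≤ ℓ ^ 8 := Nat.pow_le_pow_left hℓ.two_le 8

/-- **Lemma 6.7 for the primes `ℓ ≤ 163`, one good prime (`h67small` shape), from Mazur's torsion
theorem** — the hypothesis `h67small` of `PastenShimura2024_thm_6_1_b_of_brandtDictionary(ies)` and
of the parallel seat's `exists_dvd_of_eisenstein12_of_mazur`, through its
`small_lemma_6_7_of_lemma_6_7`. [cite: PastenShimura2024, Lemma 6.7 p. 22] [cite: Mazur1977, Thm. (8)] [cite: Katz1980, Thm. 2] -/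
theorem small_lemma_6_7_of_mazur_torsion (hMT : ∀ V : WeierstrassCurve ℚ, mazur_torsion V)
    (S : Finset ℕ) (ℓ : ℕ) (hℓ : ℓ.Prime) (hℓ163 : ℓ ≤ 163) :
    ∃ β : ℕ, ∀ (A : WeierstrassCurve ℚ) [A.IsElliptic],
      (∀ q : ℕ, q.Prime → q ∉ S → ¬ q ^ 2 ∣ A.conductorNorm ℤ) →
      ∃ r : ℕ, r.Prime ∧ ¬ r ∣ A.conductorNorm ℤ ∧
        ¬ ((ℓ ^ β : ℕ) : ℤ) ∣ (r + 1 : ℤ) - A.LFunction r :=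
  small_lemma_6_7_of_lemma_6_7 (PastenShimura2024_lemma_6_7_of_mazur_torsion hMT S) ℓ hℓ hℓ163

/-! ## II. Lemma 6.14 with the factor `12` over the verbatim Lemma 6.7 -/

/-- **Pasten 2024, Lemma 6.14 (pointwise, factor `12`) from Lemma 6.7 verbatim.** From Lemma 6.7 for
the finite set `S` (every prime `ℓ`: an exponent `β(ℓ)`, `= 1` for `ℓ > 163`, infinitely many good
`r`): one integer `κ₁ ≥ 1` supported on primes `≤ 163` such that for every elliptic `A/ℚ` of
conductor `N ≥ 1` squarefree away from `S` and every `i ≥ 1` with `i ∣ 12 (r + 1 − a_r(A))` for all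
primes `r ∤ N`: `i ∣ κ₁`. Proof as printed (p. 23), prime by prime, `κ₁ = 12 ∏_ℓ ℓ^{β(ℓ) − 1}`: a
prime `r > N` with `ℓ^{β(ℓ)} ∤ r + 1 − a_r(A)` gives `v_ℓ(i) ≤ v_ℓ(12) + β(ℓ) − 1`, which vanishes for
`ℓ > 163` (the small-prime branch of the parallel seat's `exists_dvd_of_eisenstein12_of_mazur`, run at
every prime; no appeal to Mazur's isogeny theorem). [cite: PastenShimura2024, Lemma 6.14 p. 23 (statement and proof), Lemma 6.7 p. 22] -/
theorem exists_dvd_of_eisenstein12_of_lemma_6_7 {S : Finset ℕ}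
    (h67 : ∀ ℓ : ℕ, ℓ.Prime → ∃ β : ℕ, (163 < ℓ → β = 1) ∧
      ∀ (A : WeierstrassCurve ℚ) [A.IsElliptic],
        (∀ q : ℕ, q.Prime → q ∉ S → ¬ q ^ 2 ∣ A.conductorNorm ℤ) →
        ∀ r₀ : ℕ, ∃ r : ℕ, r₀ < r ∧ r.Prime ∧ ¬ ((ℓ ^ β : ℕ) : ℤ) ∣ (r + 1 : ℤ) - A.LFunction r) :
    ∃ κ₁ : ℕ, 1 ≤ κ₁ ∧ (∀ q ∈ κ₁.primeFactors, q ≤ 163) ∧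
      ∀ (A : WeierstrassCurve ℚ) [A.IsElliptic] {N : ℕ}, 0 < N → A.conductorNorm ℤ = N →
        (∀ q : ℕ, q.Prime → q ∉ S → ¬ q ^ 2 ∣ N) →
        ∀ {i : ℕ}, 0 < i →
          (∀ r : ℕ, r.Prime → ¬ r ∣ N → (i : ℤ) ∣ ((12 : ℕ) : ℤ) * ((r + 1 : ℤ) - A.LFunction r)) →
            i ∣ κ₁ := by
  classical
  choose β hβ1 hβ2 using h67
  let α : ℕ → ℕ := fun ℓ =>
    (12 : ℕ).factorization ℓ + (if h : ℓ.Prime then β ℓ h - 1 else 0)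
  have hα : ∀ ℓ, α ℓ = (12 : ℕ).factorization ℓ + (if h : ℓ.Prime then β ℓ h - 1 else 0) :=
    fun ℓ => rfl
  have h12fac : ∀ ℓ : ℕ, 13 ≤ ℓ → (12 : ℕ).factorization ℓ = 0 := fun ℓ h13 =>
    Nat.factorization_eq_zero_of_not_dvd fun h => by
      have := Nat.le_of_dvd (by norm_num) h
      omega
  have hα0 : ∀ ℓ : ℕ, ℓ.Prime → 164 ≤ ℓ → α ℓ = 0 := by
    intro ℓ hℓ h164
    rw [hα, h12fac ℓ (by omega), dif_pos hℓ, hβ1 ℓ hℓ (by omega)]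
  refine ⟨∏ ℓ ∈ (Finset.range 164).filter Nat.Prime, ℓ ^ α ℓ,
    (one_le_prod_pow_and_primeFactors_lt 164 α).1,
    fun q hq => Nat.lt_succ_iff.mp ((one_le_prod_pow_and_primeFactors_lt 164 α).2 q hq), ?_⟩
  intro A _ N hN hAN hS i hi hEis
  refine dvd_prod_pow_of_factorization_le hi.ne' (fun ℓ hℓ => ?_) hα0
  -- a prime `r > N` (so `r ∤ N`) with `ℓ ^ β ∤ r + 1 − a_r(A)`
  obtain ⟨r, hrN, hr, hndvd⟩ := hβ2 ℓ hℓ A (fun q hq hqS => by rw [hAN]; exact hS q hq hqS) N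
  have hrN' : ¬ r ∣ N := fun h => absurd hrN (not_lt.mpr (Nat.le_of_dvd hN h))
  have hdvd := hEis r hr hrN'
  set m : ℤ := (r + 1 : ℤ) - A.LFunction r with hm
  have hm0 : m ≠ 0 := fun h0 => hndvd (by rw [h0]; exact dvd_zero _)
  have hmabs : m.natAbs ≠ 0 := Int.natAbs_ne_zero.mpr hm0
  -- `i ∣ 12 |m|` in `ℕ`
  have hdvdN : i ∣ 12 * m.natAbs := by
    have h1 : ((i : ℤ)).natAbs ∣ ((12 : ℤ) * m).natAbs :=
      Int.natAbs_dvd_natAbs.mpr (by exact_mod_cast hdvd)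
    simpa [Int.natAbs_mul] using h1
  have h12 : (12 : ℕ) ≠ 0 := by norm_num
  have hfac : i.factorization ℓ ≤ (12 : ℕ).factorization ℓ + (m.natAbs).factorization ℓ := by
    have h := (Nat.factorization_le_iff_dvd hi.ne' (mul_ne_zero h12 hmabs)).mpr hdvdN ℓ
    rwa [Nat.factorization_mul h12 hmabs, Finsupp.add_apply] at h
  -- `v_ℓ(|m|) < β`
  have hlt : (m.natAbs).factorization ℓ < β ℓ hℓ := by
    by_contra hge
    push Not at hge
    apply hndvd
    have h1 : ℓ ^ β ℓ hℓ ∣ m.natAbs := (pow_dvd_pow ℓ hge).trans (Nat.ordProj_dvd _ ℓ)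
    exact Int.natAbs_dvd_natAbs.mp (by simpa using h1)
  rw [hα, dif_pos hℓ]
  omega

/-- **Pasten 2024, Lemma 6.14 (pointwise, factor `12`), every prime from Mazur's torsion theorem**:
`exists_dvd_of_eisenstein12_of_lemma_6_7` fed with `PastenShimura2024_lemma_6_7_of_mazur_torsion` —
the parallel seat's `exists_dvd_of_eisenstein12_of_mazur` with BOTH its inputs
(`mazur_isogeny_irreducible`, `h67small`) replaced by `mazur_torsion`.
[cite: PastenShimura2024, Lemma 6.14 p. 23, Lemma 6.7 p. 22, Lemma 6.3 p. 21] [cite: Mazur1977, Thm. (8)] [cite: Katz1980, Thm. 2] -/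
theorem exists_dvd_of_eisenstein12_of_mazur_torsion
    (hMT : ∀ V : WeierstrassCurve ℚ, mazur_torsion V) (S : Finset ℕ) :
    ∃ κ₁ : ℕ, 1 ≤ κ₁ ∧ (∀ q ∈ κ₁.primeFactors, q ≤ 163) ∧
      ∀ (A : WeierstrassCurve ℚ) [A.IsElliptic] {N : ℕ}, 0 < N → A.conductorNorm ℤ = N →
        (∀ q : ℕ, q.Prime → q ∉ S → ¬ q ^ 2 ∣ N) →
        ∀ {i : ℕ}, 0 < i →
          (∀ r : ℕ, r.Prime → ¬ r ∣ N → (i : ℤ) ∣ ((12 : ℕ) : ℤ) * ((r + 1 : ℤ) - A.LFunction r)) →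
            i ∣ κ₁ :=
  exists_dvd_of_eisenstein12_of_lemma_6_7 (PastenShimura2024_lemma_6_7_of_mazur_torsion hMT S)

/-! ## III. The level side over the dictionary, Lemma 6.14's large and small primes from Mazur 1977 -/

section Dictionary

variable
  /- (`hDict`) **The character-group dictionary for `X₀^D(M)` at a prime `p ∥ M` (level side)** —
  verbatim the hypothesis `hDict` of `ShimuraCurveRibetTakahashiBrandtDictionaryProofs.lean` (see the
  documentation there: Takahashi 2001 §2 p. 78 and p. 84, Buzzard 1997 Thm. 4.7, SGA 7 IX 11.5,
  multiplicity one). -/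
  (hDict : ∀ {N D M p m : ℕ}, p.Prime → M = p * m → ¬ p ∣ m → IsAdmissibleFactorization N D M →
    ∀ (X : ShimuraCurveData D M) (W : WeierstrassCurve ℚ) [W.IsElliptic], W.conductorNorm ℤ = N →
    ∀ (W' : WeierstrassCurve ℚ) [W'.IsElliptic] (P : ShimuraParametrizationData X W'),
      P.IsMinimalFor W →
    ∀ (S : Brandt.XiSetup m (D * p)) [Fintype (Brandt.ClassSet S.O)],
      ∃ (Y : Submodule ℤ (Brandt.ClassSet S.O → ℤ)) (pb : ℤ →ₗ[ℤ] Y) (pf : Y →ₗ[ℤ] ℤ),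
        (∀ (a : ℤ) (y : Y),
            ∑ i, (Brandt.weight S.O i : ℤ) * (pb a : Brandt.ClassSet S.O → ℤ) i *
                (y : Brandt.ClassSet S.O → ℤ) i =
              ((W'.minimalDiscriminantNorm ℤ).factorization p : ℤ) * a * pf y) ∧
        (∀ a : ℤ, pf (pb a) = (P.deg : ℤ) * a) ∧
        Function.Surjective pf ∧
        (∀ (k : ℤ) (v : Brandt.ClassSet S.O → ℤ), k ≠ 0 → k • v ∈ Y → v ∈ Y) ∧
        (∀ v : Brandt.ClassSet S.O → ℤ, ∑ i, v i = 0 → v ∈ Y) ∧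
        Module.finrank ℤ
            (Brandt.eigenLattice (m * (D * p)) (Brandt.matrix S.O) (fun n => W'.LFunction n)) = 1 ∧
        (pb 1 : Brandt.ClassSet S.O → ℤ) ∈
          Brandt.eigenLattice (m * (D * p)) (Brandt.matrix S.O) (fun n => W'.LFunction n))
  (cI cJ : ∀ {D M : ℕ} {X : ShimuraCurveData D M} {W' : WeierstrassCurve ℚ},
    ShimuraParametrizationData X W' → ℕ → ℕ)
  (hcI : ∀ {D M : ℕ} {X : ShimuraCurveData D M} {W' : WeierstrassCurve ℚ}
    (P : ShimuraParametrizationData X W') (p : ℕ),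
    (∃ i : ℕ, 0 < i ∧ ∃ j : ℕ, i * j = (W'.minimalDiscriminantNorm ℤ).factorization p ∧
      P.deg * i = brandtXi (M / p) (D * p) (fun n => W'.LFunction n) * j) →
    0 < cI P p ∧ ∃ j : ℕ, cI P p * j = (W'.minimalDiscriminantNorm ℤ).factorization p ∧
      P.deg * cI P p = brandtXi (M / p) (D * p) (fun n => W'.LFunction n) * j)
  (hcJ : ∀ {D M : ℕ} {X : ShimuraCurveData D M} {W' : WeierstrassCurve ℚ}
    (P : ShimuraParametrizationData X W') (p : ℕ),
    (∃ j : ℕ, 0 < j ∧ ∃ i : ℕ, i * j = (W'.minimalDiscriminantNorm ℤ).factorization p ∧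
      P.deg * i = brandtXi (p * M) (D / p) (fun n => W'.LFunction n) * j) →
    0 < cJ P p ∧ ∃ i : ℕ, i * cJ P p = (W'.minimalDiscriminantNorm ℤ).factorization p ∧
      P.deg * i = brandtXi (p * M) (D / p) (fun n => W'.LFunction n) * cJ P p)

include hDict hcI in
/-- **Pasten 2024, Lemma 6.14 ("`i_p(D,M) ∣ κ_S`") for a selection `cI` of the level solutions, ALL
its primes from Mazur's torsion theorem.** Granted `mazur_torsion` for every elliptic curve over `ℚ`:
one `κ₁ ≥ 1` supported on primes `≤ 163` such that for `N = DM` admissible and squarefree away from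
`S`, `W` of conductor `N`, `P` minimal for `W` on `X₀^D(M)` and `p ∥ M`: `cI P p ∣ κ₁`. Proof as in
`image_dvd_of_brandtDictionary` (`cI P p` solves the level system, so
`cI P p ∣ 12 (ℓ + 1 − a_ℓ(W'))` for `ℓ ∤ N` by `eisenstein12_of_brandtDictionary`,
`a_ℓ(W') = a_ℓ(W)`), with `exists_dvd_of_eisenstein12_of_mazur_torsion` in place of
`exists_dvd_of_eisenstein12_of_mazur`. [cite: PastenShimura2024, Lemma 6.14 p. 23 (statement and proof), Lemma 6.7 p. 22] [cite: Mazur1977, Thm. (8)] [cite: Katz1980, Thm. 2] -/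
theorem image_dvd_of_brandtDictionary_of_mazur_torsion
    (hMT : ∀ V : WeierstrassCurve ℚ, mazur_torsion V) (S : Finset ℕ) :
    ∃ κ₁ : ℕ, 0 < κ₁ ∧ (∀ q ∈ κ₁.primeFactors, q ≤ 163) ∧
      ∀ {N D M : ℕ}, IsAdmissibleFactorization N D M →
      ∀ (X : ShimuraCurveData D M) (W : WeierstrassCurve ℚ) [W.IsElliptic] [W.IsGloballyMinimal],
        W.conductorNorm ℤ = N → (∀ q : ℕ, q.Prime → q ∉ S → ¬ q ^ 2 ∣ N) →
      ∀ (W' : WeierstrassCurve ℚ) [W'.IsElliptic] (P : ShimuraParametrizationData X W'),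
        P.IsMinimalFor W → ∀ p : ℕ, p.Prime → p ∣ M → ¬ p ^ 2 ∣ M → cI P p ∣ κ₁ := by
  obtain ⟨κ₁, hκ₁, hκ₁', h⟩ := exists_dvd_of_eisenstein12_of_mazur_torsion hMT S
  refine ⟨κ₁, hκ₁, hκ₁', ?_⟩
  intro N D M hadm X W _ _ hWN hSq W' _ P hP p hp hpM hp2
  obtain ⟨m, hM⟩ := hpM
  have hpm : ¬ p ∣ m := fun h1 => hp2 (by rw [hM, sq]; exact Nat.mul_dvd_mul_left p h1)
  obtain ⟨T⟩ := hadm.nonempty_xiSetup_level hp hM hpm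
  -- `cI P p` solves the level system
  obtain ⟨i, j, hi, hij, -, hδi, -⟩ :=
    levelPackage_of_brandtDictionary hDict hp hM hpm hadm X W hWN W' P hP T
  rw [← T.brandtXi_eq_xi] at hδi
  have hdiv : M / p = m := by rw [hM]; exact Nat.mul_div_cancel_left _ hp.pos
  obtain ⟨hI, j', hc', hδ'⟩ := hcI P p ⟨i, hi, j, hij, by rw [hdiv]; exact hδi⟩
  rw [hdiv, T.brandtXi_eq_xi] at hδ'
  have heis := eisenstein12_of_brandtDictionary hDict hp hM hpm hadm X W hWN W' P hP T (cI P p) j'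
    hI hc' hδ'
  -- `a_ℓ(W') = a_ℓ(W)`, and Lemma 6.14 (factor `12`) applied to `A = W`
  have hL : W'.LFunction = W.LFunction := (LFunction_eq_of_isIsogenous_holds W W' hP.1).symm
  exact h W hadm.pos hWN hSq hI fun r hr hrN => by
    have h1 := heis r hr hrN
    rw [hL] at h1
    exact_mod_cast h1

include hDict hcI hcJ in
/-- **Pasten 2024, Thm. 6.1 (b) from the dictionary, any selections `cI`, `cJ`, Lemma 6.7 from
Mazur's torsion theorem.** As `PastenShimura2024_thm_6_1_b_of_brandtDictionary_coordinates`, with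
`S = {2}` and the "`i_p ∣ κ_S`" package from `image_dvd_of_brandtDictionary_of_mazur_torsion`: the
hypotheses `hMaz` (`mazur_isogeny_irreducible`) and `h67small` are replaced by `mazur_torsion`.
[cite: PastenShimura2024, Thm. 6.1 (b) p. 20, §6.3–6.9 pp. 21–25] [cite: Takahashi2001, Thm. 2.3 (p. 79), Thm. 3.2 (a) (p. 82), p. 84] [cite: Mazur1977, Thm. (8)] -/
theorem PastenShimura2024_thm_6_1_b_of_brandtDictionary_coordinates_of_mazur_torsion
    (hMK : mazurKenku_exists_cyclic_isogeny) (hMO : mestreOesterle1989_thm_1)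
    (hP : nonempty_shimuraParametrizationData)
    (hRib : ribet1997_twoPowerFermat) (hDM : darmonMerel1997_denesEquation)
    (hFLT : FermatLastTheorem) (hMT : ∀ V : WeierstrassCurve ℚ, mazur_torsion V)
    (hT2 : ∀ {N D M p d : ℕ}, p.Prime → D = p * d → IsAdmissibleFactorization N D M →
      ∀ (X : ShimuraCurveData D M) (W : WeierstrassCurve ℚ) [W.IsElliptic],
        W.conductorNorm ℤ = N →
      ∀ (W' : WeierstrassCurve ℚ) [W'.IsElliptic] (P : ShimuraParametrizationData X W'),
        P.IsMinimalFor W →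
      ∀ S : Brandt.XiSetup (p * M) d,
        ∃ i j : ℕ, 0 < i ∧ i * j = (W'.minimalDiscriminantNorm ℤ).factorization p ∧
          i ∣ S.xi (fun n => W'.LFunction n) ∧
          P.deg * i = S.xi (fun n => W'.LFunction n) * j)
    (hI : ∀ {D M : ℕ} {X : ShimuraCurveData D M} {W' : WeierstrassCurve ℚ}
      (P : ShimuraParametrizationData X W') (p : ℕ), 0 < cI P p)
    (hJ : ∀ {D M : ℕ} {X : ShimuraCurveData D M} {W' : WeierstrassCurve ℚ}
      (P : ShimuraParametrizationData X W') (p : ℕ), 0 < cJ P p) :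
    PastenShimura2024_thm_6_1_b := by
  obtain ⟨κ₁, hκ₁, hκ₁', h614⟩ :=
    image_dvd_of_brandtDictionary_of_mazur_torsion hDict cI hcI hMT {2}
  refine PastenShimura2024_thm_6_1_b_of_ribetTakahashi_mestreOesterle_fermatQuartic cI cJ hI hJ
    (fun hp hr hpr hD hM₁ hadm X₁ X₂ W _ _ hWN W₁' _ P₁ hP₁ W₂' _ P₂ hP₂ =>
      prop_6_13_of_takahashi
        (fun hp hM hpm hadm X W _ hWN W' _ P hP S =>
          thm_2_3_level_of_brandtDictionary hDict hp hM hpm hadm X W hWN W' P hP S)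
        hT2 cI cJ hcI hcJ hp hr hpr hD hM₁ hadm X₁ X₂ W hWN W₁' P₁ hP₁ W₂' P₂ hP₂)
    (fun hadm X W _ _ hWN W' _ P hP p hp hpD =>
      coker_dvd_of_takahashi hT2 cJ hcJ hadm X W hWN W' P hP p hp hpD)
    (fun W W' _ _ hiso p hp hpN hp2 =>
      lemma_6_8_factorization_form (PastenShimura2024_lemma_6_8_of_mazurKenku' hMK) W W' hiso p hp
        hpN hp2)
    hκ₁ h614 hMO hP
    (fun _X _W _ _ _hN _hcl _W₁ _ D₁ hf hmin _W' _ _P hP => hP.deg_dvd_modularDegree D₁ hf hmin)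
    hκ₁' (Finset.mem_singleton_self 2) ?_
  -- Lemma 6.12 for `ℓ ≥ 3`
  intro W _ hFH hodd ℓ hℓ h3 k
  exact IsFreyHellegouarch.ordCompl_two_minimalDiscriminantNorm_ne_pow_of_three_le hRib hDM hℓ h3
    (hFLT ℓ h3) hFH hodd k

end Dictionary

/-! ## IV. Thm. 6.1 (b) over declarations and the two dictionaries -/

/-- **Pasten 2024, Thm. 6.1 (b) over the tree's facts and the character-group dictionary, Lemma 6.7
from Mazur's torsion theorem.** `PastenShimura2024_thm_6_1_b` from: the named facts
`mazurKenku_exists_cyclic_isogeny` (Lemma 6.8), `mestreOesterle1989_thm_1` (Lemma 6.11),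
`nonempty_shimuraParametrizationData` (Jacquet–Langlands), `ribet1997_twoPowerFermat`,
`darmonMerel1997_denesEquation`, Mathlib's statement `FermatLastTheorem` (Lemma 6.12, `ℓ ≥ 5`),
`mazur_torsion` (Lemmas 6.3 and 6.7 at EVERY prime, through Katz 1981 Thm. 2); and TWO printed
inputs as hypotheses: (`hDict`) the character-group dictionary for `X₀^D(M)` at `p ∥ M` and (`hT2`)
Takahashi's Thm. 2.3 with Thm. 3.2 (a) at `p ∣ D` (verbatim those of
`PastenShimura2024_thm_6_1_b_of_brandtDictionary`, whose `hMaz` and `h67small` are gone). The orders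
`i_p`, `j_p` of §6.6 are the selections by choice of the unique solutions of Takahashi's systems.
[cite: PastenShimura2024, Thm. 6.1 (b) p. 20, §6.3–6.9 pp. 21–25] [cite: Takahashi2001, §2 p. 78, Thm. 2.3 (p. 79), Prop. 3.1 and Thm. 3.2 (a) (p. 82), p. 84] [cite: Mazur1977, Thm. (8)] [cite: Katz1980, Thm. 2] -/
theorem PastenShimura2024_thm_6_1_b_of_brandtDictionary_of_mazur_torsion
    (hMK : mazurKenku_exists_cyclic_isogeny) (hMO : mestreOesterle1989_thm_1)
    (hP : nonempty_shimuraParametrizationData)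
    (hRib : ribet1997_twoPowerFermat) (hDM : darmonMerel1997_denesEquation)
    (hFLT : FermatLastTheorem) (hMT : ∀ V : WeierstrassCurve ℚ, mazur_torsion V)
    (hDict : ∀ {N D M p m : ℕ}, p.Prime → M = p * m → ¬ p ∣ m → IsAdmissibleFactorization N D M →
      ∀ (X : ShimuraCurveData D M) (W : WeierstrassCurve ℚ) [W.IsElliptic], W.conductorNorm ℤ = N →
      ∀ (W' : WeierstrassCurve ℚ) [W'.IsElliptic] (P : ShimuraParametrizationData X W'),
        P.IsMinimalFor W →
      ∀ (S : Brandt.XiSetup m (D * p)) [Fintype (Brandt.ClassSet S.O)],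
        ∃ (Y : Submodule ℤ (Brandt.ClassSet S.O → ℤ)) (pb : ℤ →ₗ[ℤ] Y) (pf : Y →ₗ[ℤ] ℤ),
          (∀ (a : ℤ) (y : Y),
              ∑ i, (Brandt.weight S.O i : ℤ) * (pb a : Brandt.ClassSet S.O → ℤ) i *
                  (y : Brandt.ClassSet S.O → ℤ) i =
                ((W'.minimalDiscriminantNorm ℤ).factorization p : ℤ) * a * pf y) ∧
          (∀ a : ℤ, pf (pb a) = (P.deg : ℤ) * a) ∧
          Function.Surjective pf ∧
          (∀ (k : ℤ) (v : Brandt.ClassSet S.O → ℤ), k ≠ 0 → k • v ∈ Y → v ∈ Y) ∧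
          (∀ v : Brandt.ClassSet S.O → ℤ, ∑ i, v i = 0 → v ∈ Y) ∧
          Module.finrank ℤ
              (Brandt.eigenLattice (m * (D * p)) (Brandt.matrix S.O) (fun n => W'.LFunction n)) = 1 ∧
          (pb 1 : Brandt.ClassSet S.O → ℤ) ∈
            Brandt.eigenLattice (m * (D * p)) (Brandt.matrix S.O) (fun n => W'.LFunction n))
    (hT2 : ∀ {N D M p d : ℕ}, p.Prime → D = p * d → IsAdmissibleFactorization N D M →
      ∀ (X : ShimuraCurveData D M) (W : WeierstrassCurve ℚ) [W.IsElliptic],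
        W.conductorNorm ℤ = N →
      ∀ (W' : WeierstrassCurve ℚ) [W'.IsElliptic] (P : ShimuraParametrizationData X W'),
        P.IsMinimalFor W →
      ∀ S : Brandt.XiSetup (p * M) d,
        ∃ i j : ℕ, 0 < i ∧ i * j = (W'.minimalDiscriminantNorm ℤ).factorization p ∧
          i ∣ S.xi (fun n => W'.LFunction n) ∧
          P.deg * i = S.xi (fun n => W'.LFunction n) * j) :
    PastenShimura2024_thm_6_1_b := by
  classical
  exact PastenShimura2024_thm_6_1_b_of_brandtDictionary_coordinates_of_mazur_torsion hDict
    (fun {D M} {_X} {W'} P p =>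
      if h : ∃ i : ℕ, 0 < i ∧ ∃ j : ℕ, i * j = (W'.minimalDiscriminantNorm ℤ).factorization p ∧
          P.deg * i = brandtXi (M / p) (D * p) (fun n => W'.LFunction n) * j
      then Classical.choose h else 1)
    (fun {D M} {_X} {W'} P p =>
      if h : ∃ j : ℕ, 0 < j ∧ ∃ i : ℕ, i * j = (W'.minimalDiscriminantNorm ℤ).factorization p ∧
          P.deg * i = brandtXi (p * M) (D / p) (fun n => W'.LFunction n) * j
      then Classical.choose h else 1)
    (fun P p hex => choice_spec_of_exists _ hex) (fun P p hex => choice_spec_of_exists _ hex)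
    hMK hMO hP hRib hDM hFLT hMT hT2
    (fun P p => choice_pos _ fun i hi => hi.1) (fun P p => choice_pos _ fun j hj => hj.1)

/-- **Pasten 2024, Thm. 6.1 (b) over the tree's facts and the two character-group dictionaries,
Lemma 6.7 from Mazur's torsion theorem — the trust base after this file.** As
`PastenShimura2024_thm_6_1_b_of_brandtDictionary_of_mazur_torsion`, with Takahashi's Thm. 2.3 on the
discriminant side (`hT2`) ALSO derived (`thm_2_3_disc_of_brandtDictionary`) from its dictionary
`hDictDisc` (Ribet's exact sequence / Čerednik–Drinfeld side, Takahashi Prop. 3.1 and Thm. 3.2 (a)).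
Trust base: the seven named facts `mazurKenku_exists_cyclic_isogeny`, `mestreOesterle1989_thm_1`,
`nonempty_shimuraParametrizationData`, `ribet1997_twoPowerFermat`, `darmonMerel1997_denesEquation`,
`FermatLastTheorem`, `mazur_torsion`, and the two dictionaries `hDict` (level side, `p ∥ M`, type
`(M/p, Dp)`) and `hDictDisc` (discriminant side, `p ∣ D`, type `(pM, D/p)`) — all of Takahashi's
algebra, Ribet–Takahashi's Thm. 2 for every `d`, the Eisenstein divisibility, Lemma 6.7 at every
prime (Katz + Mazur) and the whole of Pasten §6 being theorems.
[cite: PastenShimura2024, Thm. 6.1 (b) p. 20, §6.3–6.9 pp. 21–25] [cite: Takahashi2001, §2 p. 78, Thm. 2.3 (p. 79), Prop. 3.1 and Thm. 3.2 (a) (p. 82), p. 84] [cite: Mazur1977, Thm. (8)] [cite: Katz1980, Thm. 2] -/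
theorem PastenShimura2024_thm_6_1_b_of_brandtDictionaries_of_mazur_torsion
    (hMK : mazurKenku_exists_cyclic_isogeny) (hMO : mestreOesterle1989_thm_1)
    (hP : nonempty_shimuraParametrizationData)
    (hRib : ribet1997_twoPowerFermat) (hDM : darmonMerel1997_denesEquation)
    (hFLT : FermatLastTheorem) (hMT : ∀ V : WeierstrassCurve ℚ, mazur_torsion V)
    (hDict : ∀ {N D M p m : ℕ}, p.Prime → M = p * m → ¬ p ∣ m → IsAdmissibleFactorization N D M →
      ∀ (X : ShimuraCurveData D M) (W : WeierstrassCurve ℚ) [W.IsElliptic], W.conductorNorm ℤ = N →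
      ∀ (W' : WeierstrassCurve ℚ) [W'.IsElliptic] (P : ShimuraParametrizationData X W'),
        P.IsMinimalFor W →
      ∀ (S : Brandt.XiSetup m (D * p)) [Fintype (Brandt.ClassSet S.O)],
        ∃ (Y : Submodule ℤ (Brandt.ClassSet S.O → ℤ)) (pb : ℤ →ₗ[ℤ] Y) (pf : Y →ₗ[ℤ] ℤ),
          (∀ (a : ℤ) (y : Y),
              ∑ i, (Brandt.weight S.O i : ℤ) * (pb a : Brandt.ClassSet S.O → ℤ) i *
                  (y : Brandt.ClassSet S.O → ℤ) i =
                ((W'.minimalDiscriminantNorm ℤ).factorization p : ℤ) * a * pf y) ∧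
          (∀ a : ℤ, pf (pb a) = (P.deg : ℤ) * a) ∧
          Function.Surjective pf ∧
          (∀ (k : ℤ) (v : Brandt.ClassSet S.O → ℤ), k ≠ 0 → k • v ∈ Y → v ∈ Y) ∧
          (∀ v : Brandt.ClassSet S.O → ℤ, ∑ i, v i = 0 → v ∈ Y) ∧
          Module.finrank ℤ
              (Brandt.eigenLattice (m * (D * p)) (Brandt.matrix S.O) (fun n => W'.LFunction n)) = 1 ∧
          (pb 1 : Brandt.ClassSet S.O → ℤ) ∈
            Brandt.eigenLattice (m * (D * p)) (Brandt.matrix S.O) (fun n => W'.LFunction n))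
    (hDictDisc : ∀ {N D M p d : ℕ}, p.Prime → D = p * d → IsAdmissibleFactorization N D M →
      ∀ (X : ShimuraCurveData D M) (W : WeierstrassCurve ℚ) [W.IsElliptic], W.conductorNorm ℤ = N →
      ∀ (W' : WeierstrassCurve ℚ) [W'.IsElliptic] (P : ShimuraParametrizationData X W'),
        P.IsMinimalFor W →
      ∀ (S : Brandt.XiSetup (p * M) d) [Fintype (Brandt.ClassSet S.O)],
        ∃ (Y : Submodule ℤ (Brandt.ClassSet S.O → ℤ)) (pb : ℤ →ₗ[ℤ] Y) (pf : Y →ₗ[ℤ] ℤ),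
          (∀ (a : ℤ) (y : Y),
              ∑ i, (Brandt.weight S.O i : ℤ) * (pb a : Brandt.ClassSet S.O → ℤ) i *
                  (y : Brandt.ClassSet S.O → ℤ) i =
                ((W'.minimalDiscriminantNorm ℤ).factorization p : ℤ) * a * pf y) ∧
          (∀ a : ℤ, pf (pb a) = (P.deg : ℤ) * a) ∧
          Function.Surjective pf ∧
          (∀ (k : ℤ) (v : Brandt.ClassSet S.O → ℤ), k ≠ 0 → k • v ∈ Y → v ∈ Y) ∧
          Module.finrank ℤ
              (Brandt.eigenLattice (p * M * d) (Brandt.matrix S.O) (fun n => W'.LFunction n)) = 1 ∧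
          (pb 1 : Brandt.ClassSet S.O → ℤ) ∈
            Brandt.eigenLattice (p * M * d) (Brandt.matrix S.O) (fun n => W'.LFunction n)) :
    PastenShimura2024_thm_6_1_b :=
  PastenShimura2024_thm_6_1_b_of_brandtDictionary_of_mazur_torsion hMK hMO hP hRib hDM hFLT hMT hDict
    (fun hp hD hadm X W _ hWN W' _ P hP S =>
      thm_2_3_disc_of_brandtDictionary hDictDisc hp hD hadm X W hWN W' P hP S)

end Literature.NumberTheory.Automorphic

end
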